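import Mathlib
import Literature.AlgebraicGeometry.Resolution.AffineDomainEquidim
import Literature.AlgebraicGeometry.Resolution.AffineDomainDimension
import Literature.AlgebraicGeometry.Resolution.BlowupChartTransition
import Literature.RingTheory.KrullDimension.LocalizationDimension
import HarnessLib

/-!
# Crux `FrobeniusLadder.FRationalResolution` (stmt-ResolutionOfSingularities-15317), line `redirect`,
# stub `stub_diagonalizableQuotientResolution` — THE DIMENSION SLOT OF THE SECOND-STEP CHART DATA: `dim T[J/y]_𝔪 = dim T` at
# every maximal ideal of a chart ring of an affine domain

`…LocalToricModelBlowupAtPrime` (p843354) needs `dim C_𝔫 = rank P'` at the prime `𝔫` of the chart ring `C = T[J/y]` carrying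
chart data by `P'`; for the cones of a fan subdivision `rank P' = rank P = dim T`, so what is needed is `dim C_𝔫 = dim T` for
MAXIMAL `𝔫`. For `T` a domain of finite type over a field and `0 ≠ y`: `C = T[J/y] ⊆ T[1/y]` is again a domain of finite type over
the field with the same transcendence degree, hence the same dimension (Matsumura Thm. 5.6), and its local rings at maximal
ideals have that dimension (equidimensionality of affine domains, `ringKrullDim_localization_atPrime_eq_of_isMaximal`).

* `isDomain_blowupAlgebra`, `algebraMap_blowupAlgebra_injective`;
* ★ `ringKrullDim_blowupAlgebra_eq` — `dim T[J/y] = dim T`;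
* ★★ `ringKrullDim_localization_blowupAlgebra_of_isMaximal` — `dim T[J/y]_𝔪 = dim T` for `𝔪` maximal.

Honest label: elementary commutative algebra toward ONE leaf stub (no stub, crux or summit closed). No definitions, no named facts,
no sorry. [cite: Matsumura1987, Thm. 5.6 and Ex. 5.1] [cite: GortzWedhorn2020, (13.19) p. 415]
-/

noncomputable section

-- single-problem summit: the doubled namespace component is forced
set_option linter.dupNamespace false

open Literature.AlgebraicGeometry.Resolution Literature.RingTheory.KrullDimension

namespace Summit.ResolutionOfSingularities.ResolutionOfSingularities.Theorems.FRationalResolution.BlowupAlgebraDimension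

variable {T : Type} [CommRing T] [IsDomain T] (J : Ideal T) {y : T}

/-- `T[J/y] ⊆ T[1/y]` is a domain for `y ≠ 0` in a domain `T`. [folklore] -/
theorem isDomain_blowupAlgebra (hy : y ≠ 0) : IsDomain (blowupAlgebra J y) := by
  haveI : IsDomain (Localization.Away y) :=
    IsLocalization.isDomain_localization (powers_le_nonZeroDivisors_of_noZeroDivisors hy)
  infer_instance

/-- `T → T[J/y]` is injective for `y ≠ 0` in a domain `T`. [folklore] -/
theorem algebraMap_blowupAlgebra_injective (hy : y ≠ 0) :
    Function.Injective (algebraMap T (blowupAlgebra J y)) := by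
  intro a b h
  have h' : algebraMap T (Localization.Away y) a = algebraMap T (Localization.Away y) b := by
    have := congrArg (Subtype.val : blowupAlgebra J y → Localization.Away y) h
    exact this
  exact IsLocalization.injective (Localization.Away y) (powers_le_nonZeroDivisors_of_noZeroDivisors hy) h'

/-- ★ **`dim T[J/y] = dim T`** for `T` a domain of finite type over a field `κ` and `y ≠ 0`: both are domains of finite type over
`κ`, `T ⊆ T[J/y] ⊆ T[1/y]`, so the transcendence degrees — hence the dimensions — agree. [cite: Matsumura1987, Thm. 5.6] -/
theorem ringKrullDim_blowupAlgebra_eq (κ : Type) [Field κ] [Algebra κ T] [Algebra.FiniteType κ T] (hy : y ≠ 0) :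
    ringKrullDim (blowupAlgebra J y) = ringKrullDim T := by
  haveI : IsNoetherianRing T := Algebra.FiniteType.isNoetherianRing κ T
  haveI : IsDomain (Localization.Away y) :=
    IsLocalization.isDomain_localization (powers_le_nonZeroDivisors_of_noZeroDivisors hy)
  haveI : IsDomain (blowupAlgebra J y) := isDomain_blowupAlgebra J hy
  -- `κ`-structures through `T`
  haveI : Algebra.FiniteType T (blowupAlgebra J y) := finiteType_blowupAlgebra J y (IsNoetherian.noetherian J)
  letI : Algebra κ (blowupAlgebra J y) := ((algebraMap T (blowupAlgebra J y)).comp (algebraMap κ T)).toAlgebra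
  haveI hst : IsScalarTower κ T (blowupAlgebra J y) := IsScalarTower.of_algebraMap_eq (fun _ => rfl)
  haveI : Algebra.FiniteType κ (blowupAlgebra J y) := Algebra.FiniteType.trans (S := T) inferInstance inferInstance
  haveI : Algebra.FiniteType κ (Localization.Away y) := inferInstance
  -- dimensions are transcendence degrees
  obtain ⟨nT, hdT, htT⟩ := exists_ringKrullDim_eq_and_trdeg_eq κ T
  obtain ⟨nC, hdC, htC⟩ := exists_ringKrullDim_eq_and_trdeg_eq κ (blowupAlgebra J y)
  obtain ⟨nL, hdL, htL⟩ := exists_ringKrullDim_eq_and_trdeg_eq κ (Localization.Away y)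
  -- `trdeg T ≤ trdeg T[J/y] ≤ trdeg T[1/y]`
  have h1 : Algebra.trdeg κ T ≤ Algebra.trdeg κ (blowupAlgebra J y) :=
    trdeg_le_of_injective (IsScalarTower.toAlgHom κ T (blowupAlgebra J y)) (algebraMap_blowupAlgebra_injective J hy)
  have h2 : Algebra.trdeg κ (blowupAlgebra J y) ≤ Algebra.trdeg κ (Localization.Away y) :=
    trdeg_le_of_injective ((blowupAlgebra J y).val.restrictScalars κ) Subtype.val_injective
  -- `dim T[1/y] ≤ dim T`
  have h3 : ringKrullDim (Localization.Away y) ≤ ringKrullDim T := ringKrullDim_localization_le (Submonoid.powers y)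
  rw [htT, htC] at h1
  rw [htC, htL] at h2
  rw [hdL, hdT] at h3
  have h1' : nT ≤ nC := by exact_mod_cast h1
  have h2' : nC ≤ nL := by exact_mod_cast h2
  have h3' : nL ≤ nT := by exact_mod_cast h3
  rw [hdC, hdT]
  exact_mod_cast le_antisymm (h2'.trans h3') h1'

/-- ★★ **`dim T[J/y]_𝔪 = dim T` at every MAXIMAL ideal `𝔪` of the chart ring** (`T` a domain of finite type over a field,
`y ≠ 0`): affine domains are equidimensional at closed points. The dimension slot of the chart data of
`…LocalToricModelBlowupAtPrime` at the vertices of the second-step charts. [cite: Matsumura1987, Thm. 5.6 and Ex. 5.1] -/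
theorem ringKrullDim_localization_blowupAlgebra_of_isMaximal (κ : Type) [Field κ] [Algebra κ T] [Algebra.FiniteType κ T]
    (hy : y ≠ 0) (𝔪 : Ideal (blowupAlgebra J y)) [𝔪.IsMaximal] :
    ringKrullDim (Localization.AtPrime 𝔪) = ringKrullDim T := by
  haveI : IsNoetherianRing T := Algebra.FiniteType.isNoetherianRing κ T
  haveI : IsDomain (blowupAlgebra J y) := isDomain_blowupAlgebra J hy
  haveI : Algebra.FiniteType T (blowupAlgebra J y) := finiteType_blowupAlgebra J y (IsNoetherian.noetherian J)
  letI : Algebra κ (blowupAlgebra J y) := ((algebraMap T (blowupAlgebra J y)).comp (algebraMap κ T)).toAlgebra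
  haveI hst : IsScalarTower κ T (blowupAlgebra J y) := IsScalarTower.of_algebraMap_eq (fun _ => rfl)
  haveI : Algebra.FiniteType κ (blowupAlgebra J y) := Algebra.FiniteType.trans (S := T) inferInstance inferInstance
  rw [ringKrullDim_localization_atPrime_eq_of_isMaximal κ 𝔪]
  exact ringKrullDim_blowupAlgebra_eq J κ hy

end Summit.ResolutionOfSingularities.ResolutionOfSingularities.Theorems.FRationalResolution.BlowupAlgebraDimension

end
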